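import Summits.Ventures.LatticeQCDFlow.TrivializingMaps.ZeroPinching
import Literature.Barriers.QuantumFields.GrossWittenTransition

/-!
# An instance of COROLLARY N: the Gross–Witten point pinches the zeros of the finite-`n`
one-plaquette `U(n)` partition functions

HONEST FRAMING: exact (Metropolis-corrected) sampling algorithms for lattice gauge theory;
figures of merit are autocorrelation/cost numbers at stated couplings and volumes; no
continuum-physics claim. This file concerns the one-plaquette `U(n)` integrals
`G_n(γ) = ∫_{U(n)} e^{γ n Re tr U} dU` (Johansson's `G_n` = the tree's `gwPartitionFunction n γ`
on the eigenvalue torus) and their complexification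
`J_n(z) := ∫_{[-π,π]ⁿ} ∏_{j<k}|e^{iθ_j} - e^{iθ_k}|² exp(z · n Σ_j cos θ_j) dθ` (`= (2π)ⁿ n! G_n`
on the real axis).
The only unproved input is the tree's NAMED FACT `GrossWittenLargeNFreeEnergy` (Johansson
1998, Lemma 2.1: `n⁻² log G_n(γ) →` the Gross–Witten free energy), carried as a hypothesis.

* `gwPartitionFunction_pos`: `G_n(γ) > 0` for all `n` and all real `γ` (no real zeros).
* `mgf_gwLaw`, `log_mgf_gwLaw_div`, `complexMGF_gwLaw`: under the law `ν_n` of the eigenvalue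
  angles (Vandermonde density on the box normalised by its own mass; no Weyl constant needed)
  `mgf X_n ν_n γ = G_n(γ)/G_n(0)` for `X_n = n Σ_j cos θ_j`, so `n⁻² log mgf = f_n(γ) - f_n(0)` with
  `f_n = gwFreeEnergyN n`, and `complexMGF X_n ν_n = J_n / J_n(0)`.
* **`grossWitten_zeros_pinch`**: assuming `GrossWittenLargeNFreeEnergy`, for every `r > 0` and
  all large `n`, `J_n` has a zero `z` with `|z - 1| < r` — the tree's
  `gwFreeEnergy_not_analyticAt_one` (THIRD-order transition at `γ = 1`) fed into COROLLARY N
  (`ZeroPinching.fisherZeros_pinch_of_not_analyticAt`, `V_n = n²`, `|X_n| ≤ n²`): a third-order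
  transition pinches complex zeros exactly as a first-order one does.
* **`grossWitten_no_flowConstant`**: hence for every `r > 0` and all large `n` there is NO `C`
  continuous on `B(1, r) ⊆ ℂ` with `J_n′ = C · J_n` there (THEOREM F of `FisherObstruction`):
  in the dictionary of THEORY-1 §13–§14, the flow constant of a Lüscher trivializing flow for the
  one-plaquette `U(n)` model has no continuation to a fixed complex neighbourhood of the
  Gross–Witten point uniformly in `n` (`n²` plays the role of the volume in COROLLARY N).

References: Johansson, Math. Res. Lett. 5 (1998) 63, Lemma 2.1 [bib `Johansson1998`]; Gross,
Witten, Phys. Rev. D 21 (1980) 446 [bib `GrossWitten1980`]; Lüscher, CMP 293 (2010) 899, §4 [bib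
`Luscher2010Trivializing`]; THEORY-1.md §13.4, §21. PRIOR ART: Kölbig, Rühl, Z. Phys. C 12 (1982)
135 located these zeros numerically/asymptotically and observed their approach to `γ = 1`; here a
rigorous accumulation theorem from the real-axis limit of `n⁻² log G_n` alone (no zero asymptotics).
-/

open MeasureTheory ProbabilityTheory Filter Topology Complex Set Metric
open scoped Real NNReal ENNReal

namespace Summit.Ventures.LatticeQCDFlow.TrivializingMaps.GrossWittenPinching

open Literature.Barriers.QuantumFields
open Summit.Ventures.LatticeQCDFlow.TrivializingMaps.ZeroPinching

/-! ### Part A. Gibbs laws with a density: normalisation, `complexMGF`, `mgf` -/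

section GibbsDensity

variable {Ω : Type*} [MeasurableSpace Ω] {μ₀ : Measure Ω} {w : Ω → ℝ≥0}

/-- The total mass of `μ₀` with an `ℝ≥0`-valued density `w` is `∫⁻ w ∂μ₀`. -/
theorem withDensity_univ (w : Ω → ℝ≥0) :
    μ₀.withDensity (fun ω => (w ω : ℝ≥0∞)) univ = ∫⁻ ω, (w ω : ℝ≥0∞) ∂μ₀ := by
  rw [withDensity_apply _ MeasurableSet.univ, Measure.restrict_univ]

/-- **The Gibbs law of a density.** If `0 < ∫⁻ w ∂μ₀ < ∞`, normalising `w · μ₀` by its own mass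
gives a probability measure. -/
theorem isProbabilityMeasure_normalize (hfin : ∫⁻ ω, (w ω : ℝ≥0∞) ∂μ₀ ≠ ∞)
    (hpos : ∫⁻ ω, (w ω : ℝ≥0∞) ∂μ₀ ≠ 0) :
    IsProbabilityMeasure (((μ₀.withDensity fun ω => (w ω : ℝ≥0∞)) univ)⁻¹ •
      μ₀.withDensity fun ω => (w ω : ℝ≥0∞)) := by
  haveI : IsFiniteMeasure (μ₀.withDensity fun ω => (w ω : ℝ≥0∞)) :=
    isFiniteMeasure_withDensity hfin
  haveI : NeZero (μ₀.withDensity fun ω => (w ω : ℝ≥0∞)) := ⟨by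
    rw [← Measure.measure_univ_ne_zero, withDensity_univ]; exact hpos⟩
  infer_instance

/-- Under the normalised Gibbs law, `complexMGF X ν z = (∫⁻ w)⁻¹ • ∫ w e^{zX} dμ₀`. -/
theorem complexMGF_normalize (hw : Measurable w) (X : Ω → ℝ) (z : ℂ) :
    complexMGF X (((μ₀.withDensity fun ω => (w ω : ℝ≥0∞)) univ)⁻¹ •
        μ₀.withDensity fun ω => (w ω : ℝ≥0∞)) z =
      ((∫⁻ ω, (w ω : ℝ≥0∞) ∂μ₀).toReal)⁻¹ • ∫ ω, ((w ω : ℝ) : ℂ) * cexp (z * X ω) ∂μ₀ := by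
  simp only [complexMGF]
  rw [integral_smul_measure, withDensity_univ, ENNReal.toReal_inv,
    integral_withDensity_eq_integral_smul hw]
  congr 1

/-- Under the normalised Gibbs law, `mgf X ν t = (∫⁻ w)⁻¹ · ∫ w e^{tX} dμ₀`. -/
theorem mgf_normalize (hw : Measurable w) (X : Ω → ℝ) (t : ℝ) :
    mgf X (((μ₀.withDensity fun ω => (w ω : ℝ≥0∞)) univ)⁻¹ •
        μ₀.withDensity fun ω => (w ω : ℝ≥0∞)) t =
      ((∫⁻ ω, (w ω : ℝ≥0∞) ∂μ₀).toReal)⁻¹ * ∫ ω, (w ω : ℝ) * Real.exp (t * X ω) ∂μ₀ := by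
  simp only [mgf]
  rw [integral_smul_measure, withDensity_univ, ENNReal.toReal_inv,
    integral_withDensity_eq_integral_smul hw, smul_eq_mul]
  congr 1

end GibbsDensity

/-! ### Part B. The eigenvalue box, the Vandermonde weight, positivity of `G_n` -/

section Model

/-- The Vandermonde weight `∏_{j<k}|e^{iθ_j} - e^{iθ_k}|²` is continuous in the angles. -/
theorem continuous_cueWeight (n : ℕ) : Continuous (cueWeight n) := by
  unfold cueWeight
  exact continuous_finsetProd _ fun j _ => continuous_finsetProd _ fun k _ => by fun_prop

/-- Continuous functions are integrable on the (compact) eigenvalue box `[-π, π]ⁿ`. -/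
theorem integrableOn_eigenBox {n : ℕ} {E : Type*} [NormedAddCommGroup E]
    {f : (Fin n → ℝ) → E} (hf : Continuous f) : IntegrableOn f (eigenBox n) :=
  hf.continuousOn.integrableOn_compact (isCompact_univ_pi fun _ => isCompact_Icc)

/-- The scaled plaquette observable `X_n(θ) = n Σ_j cos θ_j` (`= n Re tr U`) is continuous. -/
theorem continuous_traceObs (n : ℕ) :
    Continuous fun θ : Fin n → ℝ => (n : ℝ) * ∑ j, Real.cos (θ j) := by
  fun_prop

/-- `|X_n| ≤ n²`: the observable is bounded by the "volume" `n²`. -/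
theorem abs_traceObs_le (n : ℕ) (θ : Fin n → ℝ) :
    |(n : ℝ) * ∑ j, Real.cos (θ j)| ≤ (n : ℝ) * n := by
  rw [abs_mul, Nat.abs_cast]
  refine mul_le_mul_of_nonneg_left ((Finset.abs_sum_le_sum_abs _ _).trans ?_) n.cast_nonneg
  have h : ∑ j : Fin n, |Real.cos (θ j)| ≤ ∑ _j : Fin n, (1 : ℝ) :=
    Finset.sum_le_sum fun j _ => Real.abs_cos_le_one _
  simpa using h

/-- Two real angles less than `2π` apart with the same point on the unit circle are equal. -/
theorem eq_of_cexp_mul_I_eq {a b : ℝ} (hab : |a - b| < 2 * π)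
    (h : cexp (a * I) = cexp (b * I)) : a = b := by
  obtain ⟨m, hm⟩ := Complex.exp_eq_exp_iff_exists_int.mp h
  have him : a = b + m * (2 * π) := by simpa using congrArg Complex.im hm
  have h1 : |(m : ℝ)| * (2 * π) < 1 * (2 * π) := by
    have : |a - b| = |(m : ℝ)| * (2 * π) := by
      rw [him, add_sub_cancel_left, abs_mul, abs_of_pos Real.two_pi_pos]
    linarith
  have h2 : |m| < 1 := by exact_mod_cast lt_of_mul_lt_mul_right h1 Real.two_pi_pos.le
  rw [him, Int.abs_lt_one_iff.mp h2]; simp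

/-- **Positivity of Vandermonde-weighted integrals**: for continuous `g > 0`,
`∫_{[-π,π]ⁿ} ∏_{j<k}|e^{iθ_j} - e^{iθ_k}|² g dθ > 0` (the weight is non-zero on the ball of radius
`1/(4(n+1))` around the equally spaced configuration `θ_j = j/(n+1)`, inside the box). -/
theorem integral_cueWeight_mul_pos (n : ℕ) {g : (Fin n → ℝ) → ℝ} (hg : Continuous g)
    (hgpos : ∀ θ, 0 < g θ) : 0 < ∫ θ in eigenBox n, cueWeight n θ * g θ := by
  have hint : IntegrableOn (fun θ => cueWeight n θ * g θ) (eigenBox n) :=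
    integrableOn_eigenBox ((continuous_cueWeight n).mul hg)
  have hnn : 0 ≤ᵐ[volume.restrict (eigenBox n)] fun θ => cueWeight n θ * g θ :=
    ae_of_all _ fun θ => mul_nonneg (cueWeight_nonneg n θ) (hgpos θ).le
  rw [setIntegral_pos_iff_support_of_nonneg_ae hnn hint]
  set θ₀ : Fin n → ℝ := fun j => (j : ℝ) / (n + 1) with hθ₀
  have hn1 : (0 : ℝ) < n + 1 := by positivity
  set δ : ℝ := 1 / (4 * (n + 1)) with hδ
  have hδ0 : 0 < δ := by positivity
  have hδq : δ ≤ 1 / 4 := by rw [hδ]; exact one_div_le_one_div_of_le (by norm_num) (by linarith)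
  have h4δ : 1 / (n + 1 : ℝ) = 4 * δ := by rw [hδ]; field_simp
  have hθ₀b : ∀ j : Fin n, 0 ≤ θ₀ j ∧ θ₀ j < 1 := fun j => ⟨by positivity,
    (div_lt_one hn1).mpr (by have hj : (j : ℝ) < n := (by exact_mod_cast j.isLt); linarith)⟩
  have hball : ball θ₀ δ ⊆ Function.support (fun θ => cueWeight n θ * g θ) ∩ eigenBox n := by
    intro θ hθ
    rw [mem_ball, dist_pi_lt_iff hδ0] at hθ
    have hθj : ∀ j, |θ j - θ₀ j| < δ := fun j => by rw [← Real.dist_eq]; exact hθ j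
    refine ⟨?_, ?_⟩
    · -- the weight (and `g`) do not vanish: the angles are pairwise distinct mod `2π`
      rw [Function.mem_support]
      refine mul_ne_zero ?_ (hgpos θ).ne'
      unfold cueWeight
      refine Finset.prod_ne_zero_iff.mpr fun j _ => Finset.prod_ne_zero_iff.mpr fun k hk => ?_
      have hjk : j < k := Finset.mem_Ioi.mp hk
      refine pow_ne_zero _ (norm_ne_zero_iff.mpr (sub_ne_zero.mpr fun heq => ?_))
      have hjk' : ((j : ℕ) : ℝ) + 1 ≤ ((k : ℕ) : ℝ) := by exact_mod_cast hjk
      have hjk1 : (1 : ℝ) ≤ (k : ℝ) - j := by linarith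
      have hkn' : ((k : ℕ) : ℝ) < n := by exact_mod_cast k.isLt
      have hkn : (k : ℝ) - j ≤ n := by linarith [(Nat.cast_nonneg (j : ℕ) : (0 : ℝ) ≤ j)]
      have hdiff : θ₀ k - θ₀ j = ((k : ℝ) - j) / (n + 1) := by rw [hθ₀]; ring
      have hlow : 1 / (n + 1) ≤ θ₀ k - θ₀ j := by
        rw [hdiff]; exact div_le_div_of_nonneg_right hjk1 hn1.le
      have hupp : θ₀ k - θ₀ j ≤ 1 := by rw [hdiff, div_le_one hn1]; linarith
      have hj := hθj j; have hk := hθj k; rw [abs_lt] at hj hk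
      have hsep : 0 < θ k - θ j := by linarith
      have hclose : |θ j - θ k| < 2 * π := by
        rw [abs_sub_comm, abs_of_pos hsep]; linarith [Real.pi_gt_three]
      exact absurd (eq_of_cexp_mul_I_eq hclose heq) (by linarith)
    · -- inside the box
      simp only [eigenBox, Set.mem_pi, Set.mem_univ, true_implies, Set.mem_Icc]
      intro j
      have hj := hθj j; rw [abs_lt] at hj; obtain ⟨h0, h1⟩ := hθ₀b j
      constructor <;> linarith [Real.pi_gt_three]
  exact lt_of_lt_of_le (measure_ball_pos volume θ₀ hδ0) (measure_mono hball)

/-- `∫_{[-π,π]ⁿ} ∏_{j<k}|e^{iθ_j} - e^{iθ_k}|² dθ > 0` (the un-normalised eigenvalue mass). -/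
theorem integral_cueWeight_pos (n : ℕ) : 0 < ∫ θ in eigenBox n, cueWeight n θ := by
  simpa using integral_cueWeight_mul_pos n continuous_const (fun _ => one_pos)

/-- **`G_n(γ) > 0`** for every `n` and every real `γ`: the one-plaquette `U(n)` partition
function has no real zeros. -/
theorem gwPartitionFunction_pos (n : ℕ) (γ : ℝ) : 0 < gwPartitionFunction n γ := by
  unfold gwPartitionFunction
  exact mul_pos (by positivity) (integral_cueWeight_mul_pos n (by fun_prop) fun θ => Real.exp_pos _)

/-- The un-normalised real integral in terms of `G_n`: `∫ ∏|…|² e^{γ X_n} = (2π)ⁿ n! G_n(γ)`. -/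
theorem integral_cueWeight_exp (n : ℕ) (γ : ℝ) :
    ∫ θ in eigenBox n, cueWeight n θ * Real.exp (γ * ((n : ℝ) * ∑ j, Real.cos (θ j))) =
      (2 * π) ^ n * (n.factorial : ℝ) * gwPartitionFunction n γ := by
  have hK : (2 * π) ^ n * (n.factorial : ℝ) ≠ 0 := by positivity
  unfold gwPartitionFunction
  rw [← mul_assoc, mul_inv_cancel₀ hK, one_mul]
  congr 1; ext θ; ring_nf

/-- The eigenvalue mass is `(2π)ⁿ n! G_n(0)`. -/
theorem integral_cueWeight_eq (n : ℕ) :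
    ∫ θ in eigenBox n, cueWeight n θ =
      (2 * π) ^ n * (n.factorial : ℝ) * gwPartitionFunction n 0 := by
  rw [← integral_cueWeight_exp n 0]
  congr 1; ext θ; simp

end Model

/-! ### Part C. The law of the eigenvalue angles and its moment generating functions -/

section Law

/-- The Vandermonde density as an `ℝ≥0`-valued measurable function. -/
theorem measurable_cueWeightNN (n : ℕ) :
    Measurable fun θ : Fin n → ℝ => (cueWeight n θ).toNNReal :=
  (continuous_cueWeight n).measurable.real_toNNReal

/-- Its `lintegral` over the box is the (finite, positive) real integral of the weight. -/
theorem lintegral_cueWeightNN (n : ℕ) :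
    ∫⁻ θ, ENNReal.ofNNReal (cueWeight n θ).toNNReal ∂(volume.restrict (eigenBox n)) =
      ENNReal.ofReal (∫ θ in eigenBox n, cueWeight n θ) := by
  have hfi : Integrable (fun θ => ((cueWeight n θ).toNNReal : ℝ))
      (volume.restrict (eigenBox n)) := by
    simp only [Real.coe_toNNReal', max_eq_left, cueWeight_nonneg]
    exact integrableOn_eigenBox (continuous_cueWeight n)
  rw [lintegral_coe_eq_integral _ hfi]
  simp only [Real.coe_toNNReal', max_eq_left, cueWeight_nonneg]

/-- **The eigenvalue law** (Vandermonde weight on the box, normalised) is a probability law. -/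
theorem isProbabilityMeasure_gwLaw (n : ℕ) :
    IsProbabilityMeasure
      ((((volume.restrict (eigenBox n)).withDensity fun θ =>
          ENNReal.ofNNReal (cueWeight n θ).toNNReal) univ)⁻¹ •
        (volume.restrict (eigenBox n)).withDensity fun θ =>
          ENNReal.ofNNReal (cueWeight n θ).toNNReal) := by
  refine isProbabilityMeasure_normalize (μ₀ := volume.restrict (eigenBox n))
    (w := fun θ => (cueWeight n θ).toNNReal) ?_ ?_ <;> rw [lintegral_cueWeightNN]
  · exact ENNReal.ofReal_ne_top
  · exact (ENNReal.ofReal_pos.mpr (integral_cueWeight_pos n)).ne'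

/-- **The complexified partition function is the complex MGF** of `X_n = n Σ cos θ_j` under the
eigenvalue law, up to the positive mass: `complexMGF X_n ν_n z = ((2π)ⁿ n! G_n(0))⁻¹ • J_n(z)`. -/
theorem complexMGF_gwLaw (n : ℕ) (z : ℂ) :
    complexMGF (fun θ : Fin n → ℝ => (n : ℝ) * ∑ j, Real.cos (θ j))
      ((((volume.restrict (eigenBox n)).withDensity fun θ =>
          ENNReal.ofNNReal (cueWeight n θ).toNNReal) univ)⁻¹ •
        (volume.restrict (eigenBox n)).withDensity fun θ =>
          ENNReal.ofNNReal (cueWeight n θ).toNNReal) z =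
      ((2 * π) ^ n * (n.factorial : ℝ) * gwPartitionFunction n 0)⁻¹ •
        ∫ θ in eigenBox n, (cueWeight n θ : ℂ) *
          cexp (z * (((n : ℝ) * ∑ j, Real.cos (θ j) : ℝ) : ℂ)) := by
  have h := complexMGF_normalize (μ₀ := volume.restrict (eigenBox n))
    (measurable_cueWeightNN n) (fun θ : Fin n → ℝ => (n : ℝ) * ∑ j, Real.cos (θ j)) z
  rw [lintegral_cueWeightNN, ENNReal.toReal_ofReal (integral_cueWeight_pos n).le,
    integral_cueWeight_eq] at h
  simp only [Real.coe_toNNReal', max_eq_left, cueWeight_nonneg] at h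
  exact h

/-- **`mgf X_n ν_n γ = G_n(γ)/G_n(0)`.** -/
theorem mgf_gwLaw (n : ℕ) (γ : ℝ) :
    mgf (fun θ : Fin n → ℝ => (n : ℝ) * ∑ j, Real.cos (θ j))
      ((((volume.restrict (eigenBox n)).withDensity fun θ =>
          ENNReal.ofNNReal (cueWeight n θ).toNNReal) univ)⁻¹ •
        (volume.restrict (eigenBox n)).withDensity fun θ =>
          ENNReal.ofNNReal (cueWeight n θ).toNNReal) γ =
      gwPartitionFunction n γ / gwPartitionFunction n 0 := by
  have h := mgf_normalize (μ₀ := volume.restrict (eigenBox n))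
    (measurable_cueWeightNN n) (fun θ : Fin n → ℝ => (n : ℝ) * ∑ j, Real.cos (θ j)) γ
  rw [lintegral_cueWeightNN, ENNReal.toReal_ofReal (integral_cueWeight_pos n).le,
    integral_cueWeight_eq] at h
  simp only [Real.coe_toNNReal', max_eq_left, cueWeight_nonneg] at h
  rw [integral_cueWeight_exp] at h; rw [h]
  have hK : (2 * π) ^ n * (n.factorial : ℝ) ≠ 0 := by positivity
  have hG0 : gwPartitionFunction n 0 ≠ 0 := (gwPartitionFunction_pos n 0).ne'
  field_simp

/-- **Free energies as pressures**: `n⁻² log mgf X_n ν_n γ = f_n(γ) - f_n(0)` with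
`f_n = gwFreeEnergyN n` (Johansson's `n⁻² log G_n`). -/
theorem log_mgf_gwLaw_div (n : ℕ) (γ : ℝ) :
    Real.log (mgf (fun θ : Fin n → ℝ => (n : ℝ) * ∑ j, Real.cos (θ j))
      ((((volume.restrict (eigenBox n)).withDensity fun θ =>
          ENNReal.ofNNReal (cueWeight n θ).toNNReal) univ)⁻¹ •
        (volume.restrict (eigenBox n)).withDensity fun θ =>
          ENNReal.ofNNReal (cueWeight n θ).toNNReal) γ) / (n : ℝ) ^ 2 =
      gwFreeEnergyN n γ - gwFreeEnergyN n 0 := by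
  rw [mgf_gwLaw, Real.log_div (gwPartitionFunction_pos n γ).ne'
    (gwPartitionFunction_pos n 0).ne', sub_div]
  rfl

end Law

/-! ### Part D. Pinching at the Gross–Witten point -/

section Pinching

/-- `J_n(γ) = (2π)ⁿ n! G_n(γ)` for real `γ`: `J_n` IS the continuation of the partition function. -/
theorem integral_cueWeight_cexp_ofReal (n : ℕ) (γ : ℝ) :
    ∫ θ in eigenBox n, (cueWeight n θ : ℂ) *
        cexp ((γ : ℂ) * (((n : ℝ) * ∑ j, Real.cos (θ j) : ℝ) : ℂ)) =
      (((2 * π) ^ n * (n.factorial : ℝ) * gwPartitionFunction n γ : ℝ) : ℂ) := by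
  rw [← integral_cueWeight_exp, ← integral_complex_ofReal]
  congr 1; ext θ
  simp only [Complex.ofReal_mul, Complex.ofReal_exp]

/-- **Pinching of the zeros at the Gross–Witten point.** Assume Johansson's large-`n` free
energy (`GrossWittenLargeNFreeEnergy`, a named fact of the tree). Then for every `r > 0` and all
large `n` the entire function
`J_n(z) = ∫_{[-π,π]ⁿ} ∏_{j<k}|e^{iθ_j} - e^{iθ_k}|² e^{z n Σ cos θ_j} dθ` — the complexified
one-plaquette `U(n)` partition function `(2π)ⁿ n! G_n` — has a zero within `r` of `γ = 1`
(COROLLARY N with `V_n = n²`: `lim n⁻² log G_n = f_GW` is not analytic at `1`). -/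
theorem grossWitten_zeros_pinch (h : GrossWittenLargeNFreeEnergy) {r : ℝ} (hr : 0 < r) :
    ∀ᶠ n : ℕ in atTop, ∃ z ∈ ball (1 : ℂ) r,
      ∫ θ in eigenBox n, (cueWeight n θ : ℂ) *
        cexp (z * (((n : ℝ) * ∑ j, Real.cos (θ j) : ℝ) : ℂ)) = 0 := by
  let ν : ∀ n : ℕ, Measure (Fin n → ℝ) := fun n =>
    (((volume.restrict (eigenBox n)).withDensity fun θ =>
        ENNReal.ofNNReal (cueWeight n θ).toNNReal) univ)⁻¹ •
      (volume.restrict (eigenBox n)).withDensity fun θ =>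
        ENNReal.ofNNReal (cueWeight n θ).toNNReal
  let X : ∀ n : ℕ, (Fin n → ℝ) → ℝ := fun n θ => (n : ℝ) * ∑ j, Real.cos (θ j)
  let V : ℕ → ℝ := fun n => ((max n 1 : ℕ) : ℝ) ^ 2
  haveI hν : ∀ n, IsProbabilityMeasure (ν n) := fun n => isProbabilityMeasure_gwLaw n
  have hXm : ∀ n, AEMeasurable (X n) (ν n) := fun n => (continuous_traceObs n).aemeasurable
  have hV : ∀ n, 1 ≤ V n := fun n => one_le_pow₀ (by exact_mod_cast le_max_right n 1)
  have hXb : ∀ n, ∀ᵐ θ ∂(ν n), |X n θ| ≤ 1 * V n := fun n => ae_of_all _ fun θ => by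
    have h1 : (n : ℝ) ≤ ((max n 1 : ℕ) : ℝ) := by exact_mod_cast le_max_left n 1
    rw [one_mul, show V n = ((max n 1 : ℕ) : ℝ) * ((max n 1 : ℕ) : ℝ) from pow_two _]
    exact (abs_traceObs_le n θ).trans (mul_le_mul h1 h1 n.cast_nonneg (n.cast_nonneg.trans h1))
  have hp : ∀ x : ℝ, |x - 1| < 1 →
      Tendsto (fun n => Real.log (mgf (X n) (ν n) x) / V n) atTop (𝓝 (gwFreeEnergy x)) := by
    intro x hx
    have hx0 : 0 ≤ x := by rw [abs_lt] at hx; linarith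
    have hlim : Tendsto (fun n => gwFreeEnergyN n x - gwFreeEnergyN n 0) atTop
        (𝓝 (gwFreeEnergy x)) := by
      have := (h x hx0).sub (h 0 le_rfl)
      rwa [gwFreeEnergy_of_le_one zero_le_one, show gwStrong 0 = 0 by simp [gwStrong],
        sub_zero] at this
    refine hlim.congr' ?_
    filter_upwards [eventually_ge_atTop 1] with n hn
    have hVn : V n = (n : ℝ) ^ 2 := by simp only [V, max_eq_left hn]
    rw [hVn]; exact (log_mgf_gwLaw_div n x).symm
  have key := fisherZeros_pinch_of_not_analyticAt hXm hV zero_le_one hXb hp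
    gwFreeEnergy_not_analyticAt_one one_pos hr
  filter_upwards [key] with n hn
  obtain ⟨s, hs, hZ⟩ := hn
  refine ⟨s, by simpa using hs, ?_⟩
  have hmass : ((2 * π) ^ n * (n.factorial : ℝ) * gwPartitionFunction n 0)⁻¹ ≠ 0 :=
    inv_ne_zero (mul_pos (by positivity) (gwPartitionFunction_pos n 0)).ne'
  rw [show complexMGF (X n) (ν n) s = _ from complexMGF_gwLaw n s] at hZ
  exact (smul_eq_zero.mp hZ).resolve_left hmass

/-- **No `n`-uniform flow constant through the Gross–Witten point.** Under the same named fact: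
for every `r > 0` and all large `n` there is NO function `C` continuous on `B(1, r) ⊆ ℂ` with
`J_n′ = C · J_n` there (THEOREM F at the zero of `grossWitten_zeros_pinch`; `J_n(1) > 0`). -/
theorem grossWitten_no_flowConstant (h : GrossWittenLargeNFreeEnergy) {r : ℝ} (hr : 0 < r) :
    ∀ᶠ n : ℕ in atTop, ¬ ∃ C : ℂ → ℂ, ContinuousOn C (ball (1 : ℂ) r) ∧
      ∀ s ∈ ball (1 : ℂ) r,
        deriv (fun z => ∫ θ in eigenBox n, (cueWeight n θ : ℂ) *
            cexp (z * (((n : ℝ) * ∑ j, Real.cos (θ j) : ℝ) : ℂ))) s =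
          C s * ∫ θ in eigenBox n, (cueWeight n θ : ℂ) *
            cexp (s * (((n : ℝ) * ∑ j, Real.cos (θ j) : ℝ) : ℂ)) := by
  filter_upwards [grossWitten_zeros_pinch h hr] with n hn
  obtain ⟨z₀, hz₀, hJz₀⟩ := hn
  have hmass : 0 < (2 * π) ^ n * (n.factorial : ℝ) * gwPartitionFunction n 0 :=
    mul_pos (by positivity) (gwPartitionFunction_pos n 0)
  obtain ⟨ν, hν, hmgf⟩ : ∃ ν : Measure (Fin n → ℝ), IsProbabilityMeasure ν ∧ ∀ z : ℂ,
      complexMGF (fun θ : Fin n → ℝ => (n : ℝ) * ∑ j, Real.cos (θ j)) ν z =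
        ((2 * π) ^ n * (n.factorial : ℝ) * gwPartitionFunction n 0)⁻¹ •
          ∫ θ in eigenBox n, (cueWeight n θ : ℂ) *
            cexp (z * (((n : ℝ) * ∑ j, Real.cos (θ j) : ℝ) : ℂ)) :=
    ⟨_, isProbabilityMeasure_gwLaw n, complexMGF_gwLaw n⟩
  haveI := hν
  have hdiff : Differentiable ℂ fun z => ∫ θ in eigenBox n, (cueWeight n θ : ℂ) *
      cexp (z * (((n : ℝ) * ∑ j, Real.cos (θ j) : ℝ) : ℂ)) := by
    have hd := (differentiable_complexMGF_of_abs_le (μ := ν) (continuous_traceObs n).aemeasurable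
      (ae_of_all _ fun θ => abs_traceObs_le n θ)).const_smul
      ((2 * π) ^ n * (n.factorial : ℝ) * gwPartitionFunction n 0)
    have e : ((2 * π) ^ n * (n.factorial : ℝ) * gwPartitionFunction n 0) •
        complexMGF (fun θ : Fin n → ℝ => (n : ℝ) * ∑ j, Real.cos (θ j)) ν =
        fun z => ∫ θ in eigenBox n, (cueWeight n θ : ℂ) *
          cexp (z * (((n : ℝ) * ∑ j, Real.cos (θ j) : ℝ) : ℂ)) := by
      ext z; rw [Pi.smul_apply, hmgf, smul_smul, mul_inv_cancel₀ hmass.ne', one_smul]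
    rwa [e] at hd
  have hJ1 : (∫ θ in eigenBox n, (cueWeight n θ : ℂ) *
      cexp ((1 : ℂ) * (((n : ℝ) * ∑ j, Real.cos (θ j) : ℝ) : ℂ))) ≠ 0 := by
    have := integral_cueWeight_cexp_ofReal n 1
    rw [Complex.ofReal_one] at this; rw [this]
    exact_mod_cast (mul_pos (by positivity) (gwPartitionFunction_pos n 1)).ne'
  exact Fisher.no_continuous_flowConstant_at_zero isOpen_ball (convex_ball _ _).isPreconnected
    hdiff.differentiableOn (mem_ball_self hr) hJ1 hz₀ hJz₀

end Pinching

end Summit.Ventures.LatticeQCDFlow.TrivializingMaps.GrossWittenPinching
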